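import Mathlib
import Summits.Ventures.PercRepro2.BHKPair

/-!
# Row 2′C1, the H-determinant — part I: fresh-graph probabilities and linearity
(blind cell PercRepro2, p2 g31)

Tools for `RowC1DetH.lean`: `freshH p ends a₂ x K = P_{G∖K}(x ∈ C(a₂))` (the probability, after
closing every edge at `K`, that `x` lies in the cluster of `a₂`; antitone in `K`, in `[0, 1]`), the
four Harris inequalities in the fresh graph `G ∖ K` for the pairs `(b ∈ / ∉ C(a₂), o ∈ / ∉ C(a₂))`,
and the four linear expansions `E[(1 − u) w] = E[w] − E[u w]` etc. of the expectation.  Std axioms.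
-/

namespace Summit.Ventures.PercRepro2

namespace RowC1

section DetHFresh

open Classical

variable {V : Type*} {E : Type*} [Fintype E] [DecidableEq E] [Fintype V] [DecidableEq V]
  {R : Type*} [CommRing R] [LinearOrder R] [IsStrictOrderedRing R]

omit [Fintype E] [DecidableEq E] [Fintype V] [DecidableEq V] in
/-- `{C : x ∈ C}` is an up-set of vertex sets. -/
lemma isUpperSet_memFamily (x : V) : IsUpperSet {C : Set V | x ∈ C} :=
  fun _ _ h hx => h hx

/-- `f_x(K) = P_{G∖K}(x ∈ C(a₂))`: the fresh probability that `x` lies in the cluster of `a₂` after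
closing every edge at `K`. -/
noncomputable def freshH (p : E → R) (ends : E → Sym2 V) (a₂ x : V) (K : Set V) : R :=
  delClusterProb p ends a₂ {C : Set V | x ∈ C} K

omit [Fintype V] [DecidableEq V] in
/-- `f_x` is antitone in `K`. -/
lemma freshH_anti (p : E → R) (hp : IsProbVec p) (ends : E → Sym2 V) (a₂ x : V) :
    Antitone (freshH p ends a₂ x) :=
  delClusterProb_anti p hp ends a₂ (isUpperSet_memFamily x)

omit [Fintype V] [DecidableEq V] in
/-- `0 ≤ f_x`. -/
lemma freshH_nonneg (p : E → R) (hp : IsProbVec p) (ends : E → Sym2 V) (a₂ x : V) (K : Set V) :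
    0 ≤ freshH p ends a₂ x K :=
  delClusterProb_nonneg p hp ends a₂ _ K

omit [Fintype V] [DecidableEq V] in
/-- `f_x ≤ 1`. -/
lemma freshH_le_one (p : E → R) (hp : IsProbVec p) (ends : E → Sym2 V) (a₂ x : V) (K : Set V) :
    freshH p ends a₂ x K ≤ 1 :=
  delClusterProb_le_one p hp ends a₂ _ K

/-- The fresh event `{x ∈ C(a₂) in G ∖ K}`. -/
def freshEv (ends : E → Sym2 V) (a₂ x : V) (K : Set V) : Set (Config E) :=
  {ω | x ∈ cluster ends (delConfig ends K ω) a₂}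

omit [Fintype E] [DecidableEq E] [Fintype V] [DecidableEq V] in
/-- The fresh event is increasing. -/
lemma isUpperSet_freshEv (ends : E → Sym2 V) (a₂ x : V) (K : Set V) :
    IsUpperSet (freshEv ends a₂ x K) := by
  intro ω ω' h hx
  exact cluster_mono (BHKPair.delConfig_mono_config ends K h) a₂ hx

omit [Fintype V] [DecidableEq V] [LinearOrder R] [IsStrictOrderedRing R] in
/-- `f_x(K) = P(freshEv x K)`. -/
lemma freshH_eq_prob (p : E → R) (ends : E → Sym2 V) (a₂ x : V) (K : Set V) :
    freshH p ends a₂ x K = prob p (freshEv ends a₂ x K) := rfl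

omit [Fintype V] [DecidableEq V] in
/-- **Harris in `G ∖ K`, both in**: `f_b f_o ≤ P_{G∖K}(b, o ∈ C(a₂))`. -/
lemma fresh_both_ge (p : E → R) (hp : IsProbVec p) (ends : E → Sym2 V) (a₂ o b : V) (K : Set V) :
    freshH p ends a₂ b K * freshH p ends a₂ o K ≤
      delClusterProb p ends a₂ {C : Set V | b ∈ C ∧ o ∈ C} K := by
  have e : ({ω | cluster ends (delConfig ends K ω) a₂ ∈ {C : Set V | b ∈ C ∧ o ∈ C}} :
      Set (Config E)) = freshEv ends a₂ b K ∩ freshEv ends a₂ o K := by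
    ext ω; exact Iff.rfl
  unfold delClusterProb
  rw [e, freshH_eq_prob, freshH_eq_prob]
  exact prob_mul_prob_le_prob_inter hp (isUpperSet_freshEv ends a₂ b K) (isUpperSet_freshEv ends a₂ o K)

omit [Fintype V] [DecidableEq V] in
/-- **Harris in `G ∖ K`, both out**: `(1 − f_b)(1 − f_o) ≤ P_{G∖K}(b, o ∉ C(a₂))`. -/
lemma fresh_neither_ge (p : E → R) (hp : IsProbVec p) (ends : E → Sym2 V) (a₂ o b : V)
    (K : Set V) :
    (1 - freshH p ends a₂ b K) * (1 - freshH p ends a₂ o K) ≤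
      delClusterProb p ends a₂ {C : Set V | b ∉ C ∧ o ∉ C} K := by
  have e : ({ω | cluster ends (delConfig ends K ω) a₂ ∈ {C : Set V | b ∉ C ∧ o ∉ C}} :
      Set (Config E)) = (freshEv ends a₂ b K)ᶜ ∩ (freshEv ends a₂ o K)ᶜ := by
    ext ω; exact Iff.rfl
  unfold delClusterProb
  rw [e, freshH_eq_prob, freshH_eq_prob, ← prob_compl, ← prob_compl]
  exact prob_mul_prob_le_prob_inter_of_isLowerSet hp (isUpperSet_freshEv ends a₂ b K).compl
    (isUpperSet_freshEv ends a₂ o K).compl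

omit [Fintype V] [DecidableEq V] in
/-- **Harris in `G ∖ K`, `b` in, `o` out**: `P_{G∖K}(b ∈ C(a₂), o ∉ C(a₂)) ≤ f_b (1 − f_o)`. -/
lemma fresh_b_in_o_out_le (p : E → R) (hp : IsProbVec p) (ends : E → Sym2 V) (a₂ o b : V)
    (K : Set V) :
    delClusterProb p ends a₂ {C : Set V | b ∈ C ∧ o ∉ C} K ≤
      freshH p ends a₂ b K * (1 - freshH p ends a₂ o K) := by
  have e : ({ω | cluster ends (delConfig ends K ω) a₂ ∈ {C : Set V | b ∈ C ∧ o ∉ C}} :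
      Set (Config E)) = (freshEv ends a₂ o K)ᶜ ∩ freshEv ends a₂ b K := by
    ext ω; exact ⟨fun h => ⟨h.2, h.1⟩, fun h => ⟨h.2, h.1⟩⟩
  unfold delClusterProb
  rw [e, freshH_eq_prob, freshH_eq_prob, ← prob_compl, mul_comm]
  exact prob_inter_le_prob_mul_prob_of_isLowerSet hp (isUpperSet_freshEv ends a₂ o K).compl
    (isUpperSet_freshEv ends a₂ b K)

omit [Fintype V] [DecidableEq V] in
/-- **Harris in `G ∖ K`, `b` out, `o` in**: `P_{G∖K}(b ∉ C(a₂), o ∈ C(a₂)) ≤ (1 − f_b) f_o`. -/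
lemma fresh_b_out_o_in_le (p : E → R) (hp : IsProbVec p) (ends : E → Sym2 V) (a₂ o b : V)
    (K : Set V) :
    delClusterProb p ends a₂ {C : Set V | b ∉ C ∧ o ∈ C} K ≤
      (1 - freshH p ends a₂ b K) * freshH p ends a₂ o K := by
  have e : ({ω | cluster ends (delConfig ends K ω) a₂ ∈ {C : Set V | b ∉ C ∧ o ∈ C}} :
      Set (Config E)) = (freshEv ends a₂ b K)ᶜ ∩ freshEv ends a₂ o K := by
    ext ω; exact Iff.rfl
  unfold delClusterProb
  rw [e, freshH_eq_prob, freshH_eq_prob, ← prob_compl]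
  exact prob_inter_le_prob_mul_prob_of_isLowerSet hp (isUpperSet_freshEv ends a₂ b K).compl
    (isUpperSet_freshEv ends a₂ o K)

/-! ### Linearity of the expectation (the four expansions) -/

omit [Fintype V] [DecidableEq V] [LinearOrder R] [IsStrictOrderedRing R] in
/-- `E[(1 − u) w] = E[w] − E[u w]`. -/
lemma expect_one_sub_mul (p : E → R) (u w : Config E → R) :
    expect p (fun ω => (1 - u ω) * w ω) = expect p w - expect p (fun ω => u ω * w ω) := by
  rw [← expect_sub]
  refine congrArg (expect p) (funext fun ω => ?_)
  simp only [Pi.sub_apply]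
  ring

omit [Fintype V] [DecidableEq V] [LinearOrder R] [IsStrictOrderedRing R] in
/-- `E[(1 − u)(1 − v) w] = E[w] − E[u w] − E[v w] + E[u v w]`. -/
lemma expect_one_sub_mul_one_sub_mul (p : E → R) (u v w : Config E → R) :
    expect p (fun ω => (1 - u ω) * (1 - v ω) * w ω) =
      expect p w - expect p (fun ω => u ω * w ω) - expect p (fun ω => v ω * w ω) +
        expect p (fun ω => u ω * v ω * w ω) := by
  rw [← expect_sub, ← expect_sub, ← expect_add]
  refine congrArg (expect p) (funext fun ω => ?_)
  simp only [Pi.sub_apply, Pi.add_apply]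
  ring

omit [Fintype V] [DecidableEq V] [LinearOrder R] [IsStrictOrderedRing R] in
/-- `E[u (1 − v) w] = E[u w] − E[u v w]`. -/
lemma expect_mul_one_sub_mul (p : E → R) (u v w : Config E → R) :
    expect p (fun ω => u ω * (1 - v ω) * w ω) =
      expect p (fun ω => u ω * w ω) - expect p (fun ω => u ω * v ω * w ω) := by
  rw [← expect_sub]
  refine congrArg (expect p) (funext fun ω => ?_)
  simp only [Pi.sub_apply]
  ring

omit [Fintype V] [DecidableEq V] [LinearOrder R] [IsStrictOrderedRing R] in
/-- `E[(1 − u) v w] = E[v w] − E[u v w]`. -/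
lemma expect_one_sub_mul_mul (p : E → R) (u v w : Config E → R) :
    expect p (fun ω => (1 - u ω) * v ω * w ω) =
      expect p (fun ω => v ω * w ω) - expect p (fun ω => u ω * v ω * w ω) := by
  rw [← expect_sub]
  refine congrArg (expect p) (funext fun ω => ?_)
  simp only [Pi.sub_apply]
  ring

end DetHFresh

end RowC1

end Summit.Ventures.PercRepro2
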